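import Summits.CriticalPhenomena.PercolationContinuityZ3.Theorems.Transplant.Slab111HubXUTabs
import Summits.CriticalPhenomena.PercolationContinuityZ3.Theorems.Transplant.Slab111HubXT00Tabs
import Summits.CriticalPhenomena.PercolationContinuityZ3.Theorems.Transplant.Slab111HubXT01Tabs
import Summits.CriticalPhenomena.PercolationContinuityZ3.Theorems.Transplant.Slab111HubXT02Tabs
import Summits.CriticalPhenomena.PercolationContinuityZ3.Theorems.Transplant.Slab111HubXT03Tabs
import Summits.CriticalPhenomena.PercolationContinuityZ3.Theorems.Transplant.Slab111HubXT11Tabs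
import Summits.CriticalPhenomena.PercolationContinuityZ3.Theorems.Transplant.Slab111HubXT12Tabs
import Summits.CriticalPhenomena.PercolationContinuityZ3.Theorems.Transplant.Slab111HubXT13Tabs
import Summits.CriticalPhenomena.PercolationContinuityZ3.Theorems.Transplant.Slab111HubXS00Tabs
import Summits.CriticalPhenomena.PercolationContinuityZ3.Theorems.Transplant.Slab111HubXS01Tabs
import Summits.CriticalPhenomena.PercolationContinuityZ3.Theorems.Transplant.Slab111HubXS02Tabs
import Summits.CriticalPhenomena.PercolationContinuityZ3.Theorems.Transplant.Slab111HubXS03Tabs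
import Summits.CriticalPhenomena.PercolationContinuityZ3.Theorems.Transplant.Slab111HubXS11Tabs
import Summits.CriticalPhenomena.PercolationContinuityZ3.Theorems.Transplant.Slab111HubXS12Tabs
import Summits.CriticalPhenomena.PercolationContinuityZ3.Theorems.Transplant.Slab111HubXS13Tabs
import Summits.CriticalPhenomena.PercolationContinuityZ3.Theorems.Transplant.HexShadowVLinkageNode
import HarnessLib

/-!
# The ZONE-FREE hub routing of the `(111)`-films, FINAL: `ShapedLinkage 3 (Slab111.hexShadow k)` for every `k ≥ 10`, and the `(111)`-film node for `k ≥ 10` independently of p205010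

builds on p205010 (kernel theorem, internal audit signed; external expert review pending) — NOT used in this file or anywhere in this chain:
this is the p205010-INDEPENDENT certification of `Slab111OwnCriticalContinuity k` for `10 ≤ k` (gen 36, «Slab111HubFinal»: `51 ≤ k`; the by-name
node is also closed for every `k` via p205010 in «Slab111OwnCriticalContinuityHolds»).  Lane `prim-bschramm`, seat `prim-bschramm-p2` (gen 37;
class C1b; memo `HOME/bschramm/P2-LATTICES.md` §135); helper file (`--supports stmt-CriticalPhenomena-4575 --as helper`).
**`shapedLinkage_three_ten`**: by block type, exactly as «Slab111HubFinal».`shapedLinkage_three` but from the zone-free certificates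
(`xlinkage_<SH>`, files `Slab111HubX<SH>Tabs`): both directions unclipped inside radius `2` → shape `U`; `t_R ≤ 1` → shapes `T t_R t_D`; `s_R ≤ 1` →
shapes `S s_R s_D`.  **`slab111OwnCriticalContinuity_of_hubX`**: with «HexShadowVLinkageNode».`slab111OwnCriticalContinuity_of_shapedLinkage` the film
of every thickness `k ≥ 10` dies at its own critical point.
[cite: DuminilCopinSidoraviciusTassion2016, §2.3 (proof of Fact 2: the three disjoint paths γ_u, γ_v, γ_w in B_R(z))]
[cite: BenjaminiSchramm1996, Conj. 4 / Question 3]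
-/

noncomputable section

namespace Summit.CriticalPhenomena.PercolationContinuityZ3.Theorems.Transplant

open Literature.Probability.Percolation Literature.Probability.LatticeModels SimpleGraph

/-- **SHAPED LOCAL LINKAGE OF THE `(111)`-FILMS, surgery radius `3`, every thickness `k ≥ 10`** (zone-free certificates). [cite: DuminilCopinSidoraviciusTassion2016, §2.3] -/
theorem Slab111.shapedLinkage_three_ten {k : ℕ} (hk : 10 ≤ k) : (Slab111.hexShadow k).ShapedLinkage 3 := by
  intro z tR tD sR sD htD hsD hone
  by_cases hU : 2 ≤ tR ∧ 2 ≤ sR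
  · exact Slab111.xlinkage_U hk z hU.1 hU.2 htD hsD
  rcases hone with h3 | h3
  · -- `3 ≤ t_R`, hence `s_R ≤ 1`: the S-shapes
    have hs : sR = 0 ∨ sR = 1 := by omega
    rcases hs with rfl | rfl
    · rcases Nat.lt_or_ge sD 3 with hlt | hge
      · interval_cases sD
        · exact Slab111.xlinkage_S00 hk z h3 htD rfl
        · exact Slab111.xlinkage_S01 hk z h3 htD rfl
        · exact Slab111.xlinkage_S02 hk z h3 htD rfl
      · exact Slab111.xlinkage_S03 hk z h3 htD hge
    · rcases Nat.lt_or_ge sD 3 with hlt | hge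
      · interval_cases sD
        · exact Slab111.xlinkage_S11 hk z h3 htD rfl
        · exact Slab111.xlinkage_S12 hk z h3 htD rfl
      · exact Slab111.xlinkage_S13 hk z h3 htD hge
  · -- `3 ≤ s_R`, hence `t_R ≤ 1`: the T-shapes
    have ht : tR = 0 ∨ tR = 1 := by omega
    rcases ht with rfl | rfl
    · rcases Nat.lt_or_ge tD 3 with hlt | hge
      · interval_cases tD
        · exact Slab111.xlinkage_T00 hk z rfl h3 hsD
        · exact Slab111.xlinkage_T01 hk z rfl h3 hsD
        · exact Slab111.xlinkage_T02 hk z rfl h3 hsD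
      · exact Slab111.xlinkage_T03 hk z hge h3 hsD
    · rcases Nat.lt_or_ge tD 3 with hlt | hge
      · interval_cases tD
        · exact Slab111.xlinkage_T11 hk z rfl h3 hsD
        · exact Slab111.xlinkage_T12 hk z rfl h3 hsD
      · exact Slab111.xlinkage_T13 hk z hge h3 hsD

/-- **THE `(111)`-FILM OF EVERY THICKNESS `k ≥ 10` DIES AT ITS OWN CRITICAL POINT — independently of p205010** (hexagonal-shadow transplant of
[DST16] with shaped local linkage certified by kernel-checked zone-free decision-tree certificates). [cite: DuminilCopinSidoraviciusTassion2016, Thm. 1, §2.3]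
[cite: BenjaminiSchramm1996, Conj. 4 / Question 3] -/
theorem slab111OwnCriticalContinuity_of_hubX {k : ℕ} (hk : 10 ≤ k) : Slab111OwnCriticalContinuity k :=
  slab111OwnCriticalContinuity_of_shapedLinkage (by omega) (Slab111.shapedLinkage_three_ten hk)

end Summit.CriticalPhenomena.PercolationContinuityZ3.Theorems.Transplant

end
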